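import Literature.AlgebraicGeometry.Motives.MixedHodgeStructureTensor
import HarnessLib

/-!
# `ℚ(j) ⊗ H ≅ H(j)`: Tate twists as tensor products with the Tate structure; the unit `ℚ(0) ⊗ H ≅ H`

Deligne, *Théorie de Hodge II*, 2.1.13: "Le module de Tate `ℤ(1)` est le `ℤ`-module de Hodge de
poids `-2`, purement de type `(-1,-1)` … on note … `H(n) = H ⊗ ℤ(n)`" — the Tate twist **is** the
tensor product with the Tate structure.  In the tree the twist of a mixed Hodge structure is defined by
the index shift `W_k(H(j)) = W_{k+2j}(H)`, `F^p(H(j)) = F^{p+j}(H)` (`MixedHodgeStructure.tateTwist`,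
Cattani–El Zein–Griffiths–Lê Def. 3.1.4 / §3.2.2.7 (3)) and the tensor product of MHS by
`W_r = Σ_{i+k=r} W_i ⊗ W_k`, `F^r = Σ_{a+c=r} F^a ⊗ F^c` (`MixedHodgeStructure.tensor`, §3.2.2.7 (1));
this file proves that the two agree: the canonical `ℚ ⊗_ℚ V ≅ V` (`TensorProduct.lid`) is an
isomorphism of mixed Hodge structures **`ℚ(j) ⊗ H ≅ H(j)`** (`tateTensorHom`, `tateTensorInv`), in
particular (`j = 0`) the **unit isomorphism `ℚ(0) ⊗ H ≅ H`** (`unitTensorHom`), and records the Hodge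
numbers `h^{p,q}(H(j)) = h^{p+j,q+j}(H)` and `h^{p,q}(ℚ(j) ⊗ H) = h^{p+j,q+j}(H)`.

All statements are definitions with bodies (morphisms of MHS) and theorems; no named facts.

## References

* [DeligneHodgeII1971] P. Deligne, Théorie de Hodge II, 2.1.13, 1.1.12.
* [CattaniElZeinGriffithsLe2014] E. Cattani et al. (eds.), *Hodge Theory* (2014), Def. 3.1.4,
  §3.2.2.7 (1), (3), Ex. 3.1.5.
-/

noncomputable section

open scoped TensorProduct

namespace Literature.AlgebraicGeometry.Motives

namespace MixedHodgeStructure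

universe v

variable {V : Type v} [AddCommGroup V] [Module ℚ V]

open Module
open HodgeStructure (tensorBaseChange tensorBaseChange_tmul)

/-! ### Hodge numbers of Tate twists -/

/-- **`h^{p,q}(H(j)) = h^{p+j,q+j}(H)`** (`I^{p,q}(H(j)) = I^{p+j,q+j}(H)`, the tree's `deligneI_tateTwist`,
and `h^{p,q} = dim I^{p,q}`). [cite: CattaniElZeinGriffithsLe2014, §3.2.2.7 (3) and Prop. 3.2.19] -/
theorem hodgeNumber_tateTwist [FiniteDimensional ℚ V] (H : MixedHodgeStructure V) (j p q : ℤ) :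
    (H.tateTwist j).hodgeNumber p q = H.hodgeNumber (p + j) (q + j) := by
  rw [← finrank_deligneI_eq_hodgeNumber, ← finrank_deligneI_eq_hodgeNumber, deligneI_tateTwist]

/-! ### Linear algebra: `ℚ ⊗ V ≅ V` after complexification and reassociation -/

/-- The multiplication map `(ℂ ⊗_ℚ ℚ) ⊗_ℂ (ℂ ⊗_ℚ V) → ℂ ⊗_ℚ V`, `x ⊗ y ↦ r(x) • y` with
`r : ℂ ⊗_ℚ ℚ ≅ ℂ`. [folklore] -/
private def mulMap : (ℂ ⊗[ℚ] ℚ) ⊗[ℂ] (ℂ ⊗[ℚ] V) →ₗ[ℂ] ℂ ⊗[ℚ] V :=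
  (TensorProduct.lid ℂ (ℂ ⊗[ℚ] V)).toLinearMap ∘ₗ
    LinearMap.rTensor (ℂ ⊗[ℚ] V) (TensorProduct.AlgebraTensorModule.rid ℚ ℂ ℂ).toLinearMap

/-- `mulMap (x ⊗ y) = r(x) • y`. [folklore] -/
private theorem mulMap_tmul (x : ℂ ⊗[ℚ] ℚ) (y : ℂ ⊗[ℚ] V) :
    mulMap (x ⊗ₜ[ℂ] y) = (TensorProduct.AlgebraTensorModule.rid ℚ ℂ ℂ x) • y := by
  simp only [mulMap, LinearMap.coe_comp, Function.comp_apply, LinearMap.rTensor_tmul,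
    LinearEquiv.coe_coe, TensorProduct.lid_tmul]

/-- The complexification of `ℚ ⊗_ℚ V ≅ V` is `mulMap` after the reassociation
`ℂ ⊗ (ℚ ⊗ V) ≅ (ℂ ⊗ ℚ) ⊗_ℂ (ℂ ⊗ V)`. [folklore] -/
private theorem lid_baseChange_eq (Z : ℂ ⊗[ℚ] (ℚ ⊗[ℚ] V)) :
    (TensorProduct.lid ℚ V : ℚ ⊗[ℚ] V →ₗ[ℚ] V).baseChange ℂ Z = mulMap (tensorBaseChange ℚ V Z) := by
  induction Z using TensorProduct.induction_on with
  | zero => simp only [map_zero]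
  | add x y hx hy => simp only [map_add, hx, hy]
  | tmul c z =>
    induction z using TensorProduct.induction_on with
    | zero => simp only [TensorProduct.tmul_zero, map_zero]
    | add x y hx hy => simp only [TensorProduct.tmul_add, map_add, hx, hy]
    | tmul q v =>
      rw [LinearMap.baseChange_tmul, LinearEquiv.coe_coe, TensorProduct.lid_tmul, TensorProduct.tmul_smul,
        TensorProduct.smul_tmul', tensorBaseChange_tmul, mulMap_tmul,
        TensorProduct.AlgebraTensorModule.rid_tmul, TensorProduct.smul_tmul', smul_eq_mul, mul_one]

/-- `mulMap (A ⊗ B) ⊆ B` for a `ℂ`-subspace `B`. [folklore] -/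
private theorem mulMap_map₂_le (A : Submodule ℂ (ℂ ⊗[ℚ] ℚ)) (B : Submodule ℂ (ℂ ⊗[ℚ] V)) :
    (Submodule.map₂ (TensorProduct.mk ℂ (ℂ ⊗[ℚ] ℚ) (ℂ ⊗[ℚ] V)) A B).map mulMap ≤ B := by
  rw [Submodule.map_le_iff_le_comap, Submodule.map₂_le]
  intro x _ y hy
  rw [Submodule.mem_comap, TensorProduct.mk_apply, mulMap_tmul]
  exact B.smul_mem _ hy

/-- Under the reassociation, the complexification of `v ↦ 1 ⊗ v` is `y ↦ (1 ⊗ 1) ⊗ y`. [folklore] -/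
private theorem tensorBaseChange_lidSymm_baseChange (y : ℂ ⊗[ℚ] V) :
    tensorBaseChange ℚ V (((TensorProduct.lid ℚ V).symm : V →ₗ[ℚ] ℚ ⊗[ℚ] V).baseChange ℂ y) =
      ((1 : ℂ) ⊗ₜ[ℚ] (1 : ℚ)) ⊗ₜ[ℂ] y := by
  induction y using TensorProduct.induction_on with
  | zero => simp only [map_zero, TensorProduct.tmul_zero]
  | add x y hx hy => simp only [map_add, hx, hy, TensorProduct.tmul_add]
  | tmul c v =>
    rw [LinearMap.baseChange_tmul, LinearEquiv.coe_coe, TensorProduct.lid_symm_apply, tensorBaseChange_tmul,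
      show (c ⊗ₜ[ℚ] (1 : ℚ) : ℂ ⊗[ℚ] ℚ) = c • ((1 : ℂ) ⊗ₜ[ℚ] (1 : ℚ)) by
        rw [TensorProduct.smul_tmul', smul_eq_mul, mul_one],
      TensorProduct.smul_tmul,
      show c • ((1 : ℂ) ⊗ₜ[ℚ] v) = c ⊗ₜ[ℚ] v by rw [TensorProduct.smul_tmul', smul_eq_mul, mul_one]]

variable (H : MixedHodgeStructure V) [FiniteDimensional ℚ V]

/-! ### `ℚ(j) ⊗ H ≅ H(j)` -/

/-- **`ℚ(j) ⊗ H → H(j)`, `q ⊗ v ↦ q • v`, is a morphism of mixed Hodge structures** (Deligne,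
Hodge II, 2.1.13: `H(n) = H ⊗ ℤ(n)`): `W_i(ℚ(j)) ⊗ W_k(H) ↦ ℚ • W_k(H) ⊆ W_{i+k+2j}(H)` (as
`W_i(ℚ(j)) = 0` for `i < -2j`) and `F^a ℚ(j)_ℂ ⊗ F^c H_ℂ ↦ F^c ⊆ F^{a+c+j}` (as `F^a ℚ(j) = 0` for
`a > -j`). [cite: DeligneHodgeII1971, 2.1.13] -/
def tateTensorHom (j : ℤ) :
    Hom (tensor (HodgeStructure.tate j).toMixedHodgeStructure H) (H.tateTwist j) where
  toLinearMap := (TensorProduct.lid ℚ V : ℚ ⊗[ℚ] V →ₗ[ℚ] V)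
  map_W_le n := by
    rw [tensor_W, tateTwist_W]
    simp only [Submodule.map_iSup, HodgeStructure.toMixedHodgeStructure_W]
    refine iSup₂_le fun ik (hik : ik.1 + ik.2 = n) => ?_
    by_cases hi : ik.1 < -2 * j
    · rw [HodgeStructure.trivialWeightFiltration_of_lt hi, Submodule.map₂_bot_left, Submodule.map_bot]
      exact bot_le
    · refine le_trans ?_ (H.monotone_W (show ik.2 ≤ n + 2 * j by omega))
      rw [Submodule.map_le_iff_le_comap, Submodule.map₂_le]
      intro q _ v hv
      rw [Submodule.mem_comap, TensorProduct.mk_apply, LinearEquiv.coe_coe, TensorProduct.lid_tmul]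
      exact (H.W ik.2).smul_mem q hv
  map_F_le p := by
    rw [tensor_F, tateTwist_F, Submodule.map_le_iff_le_comap]
    refine iSup₂_le fun ac (hac : ac.1 + ac.2 = p) => ?_
    intro Z hZ
    rw [Submodule.mem_comap, LinearEquiv.coe_coe, HodgeStructure.toMixedHodgeStructure_F,
      HodgeStructure.tate_F] at hZ
    rw [Submodule.mem_comap, lid_baseChange_eq]
    by_cases ha : ac.1 ≤ -j
    · rw [HodgeStructure.pureFiltration_of_le ha] at hZ
      exact H.antitone_F (show p + j ≤ ac.2 by omega) (mulMap_map₂_le _ _ ⟨_, hZ, rfl⟩)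
    · rw [HodgeStructure.pureFiltration_of_lt (not_le.1 ha), Submodule.map₂_bot_left,
        Submodule.mem_bot] at hZ
      rw [hZ, map_zero]
      exact Submodule.zero_mem _

/-- The underlying map of `ℚ(j) ⊗ H → H(j)` is `TensorProduct.lid`. [cite: DeligneHodgeII1971, 2.1.13] -/
@[simp]
theorem tateTensorHom_toLinearMap (j : ℤ) :
    (tateTensorHom H j).toLinearMap = (TensorProduct.lid ℚ V : ℚ ⊗[ℚ] V →ₗ[ℚ] V) :=
  rfl

/-- **`H(j) → ℚ(j) ⊗ H`, `v ↦ 1 ⊗ v`, is a morphism of mixed Hodge structures**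
(`W_{n+2j}(H) ↦ W_{-2j}(ℚ(j)) ⊗ W_{n+2j}(H)`, `F^{p+j} ↦ F^{-j}ℚ(j)_ℂ ⊗ F^{p+j}`).
[cite: DeligneHodgeII1971, 2.1.13] -/
def tateTensorInv (j : ℤ) :
    Hom (H.tateTwist j) (tensor (HodgeStructure.tate j).toMixedHodgeStructure H) where
  toLinearMap := ((TensorProduct.lid ℚ V).symm : V →ₗ[ℚ] ℚ ⊗[ℚ] V)
  map_W_le n := by
    rw [tateTwist_W, tensor_W, Submodule.map_le_iff_le_comap]
    intro v hv
    rw [Submodule.mem_comap, LinearEquiv.coe_coe, TensorProduct.lid_symm_apply]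
    refine (le_biSup (fun ij : ℤ × ℤ => Submodule.map₂ (TensorProduct.mk ℚ ℚ V)
      ((HodgeStructure.tate j).toMixedHodgeStructure.W ij.1) (H.W ij.2)) (i := (-2 * j, n + 2 * j))
      (show -2 * j + (n + 2 * j) = n by ring)) ?_
    dsimp only
    exact Submodule.apply_mem_map₂ _
      (by rw [HodgeStructure.toMixedHodgeStructure_W, HodgeStructure.trivialWeightFiltration_of_le le_rfl]
          exact Submodule.mem_top) hv
  map_F_le p := by
    rw [tateTwist_F, tensor_F, Submodule.map_le_iff_le_comap]
    intro y hy
    rw [Submodule.mem_comap]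
    refine (le_biSup (fun ac : ℤ × ℤ => (Submodule.map₂ (TensorProduct.mk ℂ (ℂ ⊗[ℚ] ℚ) (ℂ ⊗[ℚ] V))
        ((HodgeStructure.tate j).toMixedHodgeStructure.F ac.1) (H.F ac.2)).comap
          (tensorBaseChange ℚ V : ℂ ⊗[ℚ] (ℚ ⊗[ℚ] V) →ₗ[ℂ] _)) (i := (-j, p + j))
      (show -j + (p + j) = p by ring)) ?_
    dsimp only
    rw [Submodule.mem_comap, LinearEquiv.coe_coe, tensorBaseChange_lidSymm_baseChange]
    exact Submodule.apply_mem_map₂ _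
      (by rw [HodgeStructure.toMixedHodgeStructure_F, HodgeStructure.tate_F,
            HodgeStructure.pureFiltration_of_le le_rfl]
          exact Submodule.mem_top) hy

/-- The underlying map of `H(j) → ℚ(j) ⊗ H` is `TensorProduct.lid.symm`. [cite: DeligneHodgeII1971, 2.1.13] -/
@[simp]
theorem tateTensorInv_toLinearMap (j : ℤ) :
    (tateTensorInv H j).toLinearMap = ((TensorProduct.lid ℚ V).symm : V →ₗ[ℚ] ℚ ⊗[ℚ] V) :=
  rfl

/-- `(H(j) → ℚ(j) ⊗ H) ∘ (ℚ(j) ⊗ H → H(j)) = id`. [cite: DeligneHodgeII1971, 2.1.13] -/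
theorem tateTensorInv_comp_tateTensorHom (j : ℤ) :
    (tateTensorInv H j).comp (tateTensorHom H j) =
      Hom.id (tensor (HodgeStructure.tate j).toMixedHodgeStructure H) :=
  Hom.ext (LinearMap.ext fun x => (TensorProduct.lid ℚ V).symm_apply_apply x)

/-- `(ℚ(j) ⊗ H → H(j)) ∘ (H(j) → ℚ(j) ⊗ H) = id`. [cite: DeligneHodgeII1971, 2.1.13] -/
theorem tateTensorHom_comp_tateTensorInv (j : ℤ) :
    (tateTensorHom H j).comp (tateTensorInv H j) = Hom.id (H.tateTwist j) :=
  Hom.ext (LinearMap.ext fun x => (TensorProduct.lid ℚ V).apply_symm_apply x)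

/-- **`ℚ(j) ⊗ H ≅ H(j)` is an isomorphism of mixed Hodge structures.** [cite: DeligneHodgeII1971, 2.1.13] -/
theorem tateTensorHom_bijective (j : ℤ) : Function.Bijective (tateTensorHom H j).toLinearMap :=
  (TensorProduct.lid ℚ V).bijective

/-- **`h^{p,q}(ℚ(j) ⊗ H) = h^{p+j,q+j}(H)`.** [cite: DeligneHodgeII1971, 2.1.13] -/
theorem hodgeNumber_tate_tensor (j p q : ℤ) :
    (tensor (HodgeStructure.tate j).toMixedHodgeStructure H).hodgeNumber p q =
      H.hodgeNumber (p + j) (q + j) := by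
  rw [Hom.hodgeNumber_eq_of_bijective (tateTensorHom H j) (tateTensorHom_bijective H j),
    hodgeNumber_tateTwist]

/-! ### The unit: `ℚ(0) ⊗ H ≅ H` -/

/-- **The unit isomorphism `ℚ(0) ⊗ H → H`, `q ⊗ v ↦ q • v`** (a morphism of MHS; `ℚ(0)` is the unit
of `⊗`, Deligne 2.1.13 with `n = 0`, `H(0) = H`). [cite: DeligneHodgeII1971, 2.1.13] -/
def unitTensorHom : Hom (tensor (HodgeStructure.tate 0).toMixedHodgeStructure H) H where
  toLinearMap := (TensorProduct.lid ℚ V : ℚ ⊗[ℚ] V →ₗ[ℚ] V)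
  map_W_le n := by
    have h := (tateTensorHom H 0).map_W_le n
    rwa [tateTwist_W, show n + 2 * 0 = n by ring] at h
  map_F_le p := by
    have h := (tateTensorHom H 0).map_F_le p
    rwa [tateTwist_F, add_zero] at h

/-- **The inverse unit isomorphism `H → ℚ(0) ⊗ H`, `v ↦ 1 ⊗ v`.** [cite: DeligneHodgeII1971, 2.1.13] -/
def unitTensorInv : Hom H (tensor (HodgeStructure.tate 0).toMixedHodgeStructure H) where
  toLinearMap := ((TensorProduct.lid ℚ V).symm : V →ₗ[ℚ] ℚ ⊗[ℚ] V)
  map_W_le n := by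
    have h := (tateTensorInv H 0).map_W_le n
    rwa [tateTwist_W, show n + 2 * 0 = n by ring] at h
  map_F_le p := by
    have h := (tateTensorInv H 0).map_F_le p
    rwa [tateTwist_F, add_zero] at h

/-- The underlying map of the unit isomorphism. [cite: DeligneHodgeII1971, 2.1.13] -/
@[simp]
theorem unitTensorHom_toLinearMap :
    (unitTensorHom H).toLinearMap = (TensorProduct.lid ℚ V : ℚ ⊗[ℚ] V →ₗ[ℚ] V) :=
  rfl

/-- The underlying map of the inverse unit isomorphism. [cite: DeligneHodgeII1971, 2.1.13] -/
@[simp]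
theorem unitTensorInv_toLinearMap :
    (unitTensorInv H).toLinearMap = ((TensorProduct.lid ℚ V).symm : V →ₗ[ℚ] ℚ ⊗[ℚ] V) :=
  rfl

/-- `unitTensorInv ∘ unitTensorHom = id`. [cite: DeligneHodgeII1971, 2.1.13] -/
theorem unitTensorInv_comp_unitTensorHom :
    (unitTensorInv H).comp (unitTensorHom H) = Hom.id _ :=
  Hom.ext (LinearMap.ext fun x => (TensorProduct.lid ℚ V).symm_apply_apply x)

/-- `unitTensorHom ∘ unitTensorInv = id`. [cite: DeligneHodgeII1971, 2.1.13] -/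
theorem unitTensorHom_comp_unitTensorInv :
    (unitTensorHom H).comp (unitTensorInv H) = Hom.id H :=
  Hom.ext (LinearMap.ext fun x => (TensorProduct.lid ℚ V).apply_symm_apply x)

/-- The unit isomorphism is bijective. [cite: DeligneHodgeII1971, 2.1.13] -/
theorem unitTensorHom_bijective : Function.Bijective (unitTensorHom H).toLinearMap :=
  (TensorProduct.lid ℚ V).bijective

/-- `h^{p,q}(ℚ(0) ⊗ H) = h^{p,q}(H)`. [cite: DeligneHodgeII1971, 2.1.13] -/
theorem hodgeNumber_unit_tensor (p q : ℤ) :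
    (tensor (HodgeStructure.tate 0).toMixedHodgeStructure H).hodgeNumber p q = H.hodgeNumber p q := by
  rw [hodgeNumber_tate_tensor, add_zero, add_zero]

end MixedHodgeStructure

end Literature.AlgebraicGeometry.Motives

end
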